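/-
COR-CM (cell pub-hodgecm2, stage 2 of the Hodge ladder) — count-neutral KERNEL COMBINATORICS «the octic product column G = Q₈ × B, D₄ × B: the residual blocks are distinct»
(seat prover-pub-hodgecm2-b23-g45-0, binder prover b23, gen 45; own census lane OCTIC-PRODUCT, claim HOME/INBOX.md l.18829).  Theorems only — §2 of gen 44ʼs `Census/QuarticInversionResidualBlocks.lean` (the residual labels `kLab`/`aLab`, their invariant vectors and the injectivity of the signatures BY NAME) over the blocks of `Census/OcticProductBlocks.lean`; no `decide`, no certificate, no named fact, no `sorry`.
`Interfaces.lean` (C1), every E term, B01, `Transposition/*`, `PortJoin/*`, `D2Bridge/*` untouched.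
HONEST FRAMING: `HC_CM` is NOT proved, here or anywhere in the tree; nothing here is a period, a count of record or a headline.
T5: n/a-class (hypothesis binders = the datum equations / the slot data only); checker: self, 2026-08-24.
-/
import Summits.HodgeConjecture.CorCM.Census.QuarticInversionResidualBlocks
import Summits.HodgeConjecture.CorCM.Census.OcticProductBlocks

/-!
# The octic product column: ten (`ζ = 1`, `Q₈ × B`) resp. twelve (`ζ = 0`, `D₄ × B`) residual blocks

COR-CM (cell `pub-hodgecm2`, stage 2 of the Hodge ladder), count-neutral KERNEL COMBINATORICS by the binder seat b23 (gen 45; lane OCTIC-PRODUCT, HOME/INBOX.md l.18829 — the port of gen 44ʼs quartic inversion lane `Census/QuarticInversion*` to the datum with `y` CENTRAL on `ι(H₀)`).  On top of the corresponding parts of gen 44ʼs lane `Census/QuarticInversion*` (label-level, BY NAME) and the preceding `Census/OcticProduct*` files.  Bookkeeping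
definitions with bodies (the residual labels `kLab`, `aLab`, the index maps `kpat`, `repTen`, `repTwelve`) + theorems; `decide` only on
closed Boolean statements over at most six Boolean literals (distinct signatures), no certificate, no named fact, no geometry, no `sorry`.
`Interfaces.lean` (C1), every E term, B01, `Transposition/*`, `PortJoin/*`, `D2Bridge/*` untouched.
HONEST FRAMING: `HC_CM` is NOT proved, here or anywhere in the tree; nothing here is a period, a count of record or a headline.

CONTENT (`|B|` odd `≥ 3`, square class `ζ`).  The residual blocks (potential `< 2`) are NOT reached by the descent of part VI; the count of
part XXIII needs lower bounds for their number:
* §1 the constant labels `kLab b` (potential `0`) and the atom labels `aLab b` (`δ 0` in coordinate `0`, constants elsewhere; potential `1`),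
  their class vectors, half vectors and invariant vectors (part XXI);
* §2 **at least ten residual blocks** for every `ζ` (`ten_le_card_residual`: eight atom labels with distinct signatures and two constants of
  distinct parity) and **at least twelve for `ζ = 0`** (`twelve_le_card_residual`: two more constants, separated by the `ζ = 0` invariant).
  (Numerically these bounds are equalities: `q30.out`, `q31.out` of this folder.)  All [folklore].

## References
* [Pohlmann1968] H. Pohlmann, Algebraic cycles on abelian varieties of complex multiplication type, Ann. of Math. 88 (1968), Thm 1.
-/

namespace Summit.HodgeConjecture.CorCM.Census.OcticProduct

open Finset
open Summit.HodgeConjecture.CorCM.Census.OddSliceFacesModel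
open Summit.HodgeConjecture.CorCM.Census.OddSliceFacesSquares (clsTy)
open Summit.HodgeConjecture.CorCM.Census.OddSliceFacesDescent (wt_zero wt_delta)

open Summit.HodgeConjecture.CorCM.Census.QuarticInversion (aLab half inv_aLab inv_kLab kLab kpat pot₄_aLab pot₄_kLab sig_aLab_inj sig_kpat_inj sig_kpat_inj_zero)

noncomputable section

variable (A : Type) [AddCommGroup A] [Fintype A] [DecidableEq A] (ζ : ZMod 2)

/-! ## Ten resp. twelve residual blocks -/

/-- **At least ten residual blocks**, for every `ζ` (`|B|` odd `≥ 3`): eight atom blocks and two constant blocks. [folklore] -/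
theorem ten_le_card_residual (hA : Odd (Fintype.card A)) (h2 : 2 ≤ Fintype.card A) :
    10 ≤ (univ.filter fun B : Block A ζ => potB A ζ B < 2).card := by
  have h01 : ∀ z : ZMod 2, z = 0 ∨ z = 1 := by decide
  have h1 : 1 ≤ Fintype.card A := by omega
  let f : (Bool × Bool × Bool) ⊕ Bool → {B : Block A ζ // potB A ζ B < 2} := fun i =>
    match i with
    | Sum.inl ⟨x, y, z⟩ => ⟨blk A ζ (aLab A ![false, x, y, z]), by rw [potB_blk, pot₄_aLab A h2]; exact Nat.one_lt_two⟩
    | Sum.inr p => ⟨blk A ζ (kLab A (kpat p false)), by rw [potB_blk, pot₄_kLab]; exact Nat.zero_lt_two⟩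
  have hf : Function.Injective f := by
    rintro (⟨x, y, z⟩ | p) (⟨x', y', z'⟩ | p') hii' <;> have hb := inv_eq_of_blk_eq A ζ hA (congrArg Subtype.val hii')
    · rw [inv_aLab A ζ h2, inv_aLab A ζ h2, Prod.mk.injEq] at hb
      rw [sig_aLab_inj ζ (h01 ζ) hb.2]
    · rw [inv_aLab A ζ h2, inv_kLab A ζ h1, Prod.mk.injEq] at hb
      exact absurd hb.1 one_ne_zero
    · rw [inv_kLab A ζ h1, inv_aLab A ζ h2, Prod.mk.injEq] at hb
      exact absurd hb.1.symm one_ne_zero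
    · rw [inv_kLab A ζ h1, inv_kLab A ζ h1, Prod.mk.injEq] at hb
      rw [sig_kpat_inj ζ (h01 ζ) hb.2]
  have hcard := Fintype.card_le_of_injective f hf
  rw [Fintype.card_subtype] at hcard
  simpa using hcard

/-- **At least twelve residual blocks for `ζ = 0`** (`|B|` odd `≥ 3`): eight atom blocks and four constant blocks. [folklore] -/
theorem twelve_le_card_residual (hA : Odd (Fintype.card A)) (h2 : 2 ≤ Fintype.card A) :
    12 ≤ (univ.filter fun B : Block A 0 => potB A 0 B < 2).card := by
  have h1 : 1 ≤ Fintype.card A := by omega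
  let f : (Bool × Bool × Bool) ⊕ (Bool × Bool) → {B : Block A 0 // potB A 0 B < 2} := fun i =>
    match i with
    | Sum.inl ⟨x, y, z⟩ => ⟨blk A 0 (aLab A ![false, x, y, z]), by rw [potB_blk, pot₄_aLab A h2]; exact Nat.one_lt_two⟩
    | Sum.inr ⟨p, k⟩ => ⟨blk A 0 (kLab A (kpat p k)), by rw [potB_blk, pot₄_kLab]; exact Nat.zero_lt_two⟩
  have hf : Function.Injective f := by
    rintro (⟨x, y, z⟩ | ⟨p, k⟩) (⟨x', y', z'⟩ | ⟨p', k'⟩) hii' <;> have hb := inv_eq_of_blk_eq A 0 hA (congrArg Subtype.val hii')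
    · rw [inv_aLab A 0 h2, inv_aLab A 0 h2, Prod.mk.injEq] at hb
      rw [sig_aLab_inj 0 (Or.inl rfl) hb.2]
    · rw [inv_aLab A 0 h2, inv_kLab A 0 h1, Prod.mk.injEq] at hb
      exact absurd hb.1 one_ne_zero
    · rw [inv_kLab A 0 h1, inv_aLab A 0 h2, Prod.mk.injEq] at hb
      exact absurd hb.1.symm one_ne_zero
    · rw [inv_kLab A 0 h1, inv_kLab A 0 h1, Prod.mk.injEq] at hb
      rw [sig_kpat_inj_zero hb.2]
  have hcard := Fintype.card_le_of_injective f hf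
  rw [Fintype.card_subtype] at hcard
  simpa using hcard

end

end Summit.HodgeConjecture.CorCM.Census.OcticProduct
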